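import Literature.Analysis.FluidPDE.NSSereginMildStabilityHolds
import Literature.Analysis.FluidPDE.NSSereginMildRescaling
import HarnessLib

/-!
MAINTENANCE 2026-08-20 (ops-buildfix lane): `exists_oneScale_top_bound_of_LR` is now `exists_oneScale_top_bound_of_LR'` in this file — the unprimed fully-qualified name is ALSO
declared (a different variant of the same cited statement) in `LocalLerayUniformTopBound.lean`, and two modules declaring one name cannot be
co-imported (this broke the `Literature` root aggregate). Only the name changed; statement and proof are byte-identical.

# Tools for Albritton–Barker's backward `L³` Liouville theorem: persistence of singularities in
# quantitative form at the top of a slab, and the vanishing of zoomed-out `L³` slices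

Analysis/FluidPDE proof file (theorems only: no definition, no named fact, no `sorry`) on the
discharge path of the named fact
`Literature.Analysis.FluidPDE.AlbrittonBarker2019_liouville_L3_backward`
(`AncientL3BackwardLiouville.lean`; D. Albritton, T. Barker, *On local Type I singularities of the
Navier–Stokes equations and Liouville theorems*, J. Math. Fluid Mech. 21 (2019) no. 43 =
arXiv:1811.00502, **Thm. 1.2**, proved in §4 through Thm. 4.1 "by zooming out and the persistence
of singularities"). The discharge (`AncientL3BackwardLiouvilleProofs.lean`) re-runs the tree's
proved zoom-*in* argument of Seregin (`seregin_blowup_core`, `NSSereginBlowupCore.lean`) as the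
printed zoom-*out*; this file supplies the two tools in which the two arguments differ:

* `exists_oneScale_top_bound_of_LR'`, `singular_point_stability_unit_bound` — **persistence of
  singularities in quantitative form** (Albritton–Barker 2019, **Prop. 2.3**, arXiv p. 5: "We prove
  the contrapositive. Suppose that `u ∈ L^∞(Q(R))` … this ensures
  `limsup_k sup_{Q(r/2)} |v^{(k)}| ≤ C_CKN / r`"; Lemarié-Rieusset 2016, proof of Thm. 15.5,
  PDF pp. 571–573, (15.5)–(15.6) with Thm. 14.4). The tree's `singular_point_stability_unit`
  (`NSSereginMildStabilityCore.lean`) concludes only that each approximant `v_n`, `n` large, is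
  essentially bounded on `Q_{r₁}(T, x₀)`; its proof — reproduced here verbatim up to the last
  step — gives the bound `C₀ ε₀ / s` of Thm. 14.4 at a scale `s` chosen *before* `n`, i.e. a bound
  **uniform in `n`**, which is what the zoom-out needs (the zoomed-out copies of a bounded ancient
  solution are bounded, never singular; it is the uniformity that un-scales to `v ≡ 0`).
* `tendsto_integral_inner_zoomOut_of_memLp_three` — **zoomed-out copies of a fixed `L³` field
  vanish in `𝒟'`**: `∫ ⟪λ_n V(x₀ + λ_n x), φ(x)⟫ dx → 0` as `λ_n → +∞` (Albritton–Barker 2019, §4,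
  arXiv p. 9: `L³ ⊆ 𝔹`, the functions `f` of `Ḃ^{-1}_{∞,∞}` with "`f(λ·) → 0` in the sense of
  distributions as `λ → ∞`", and "`U^{(k)} → 0` in the sense of distributions"); the twin of the
  tree's zoom-in lemma `tendsto_integral_inner_blowup_of_memLp_three` (`λ_n → 0⁺`,
  `NSSereginMildRescaling.lean`). Proof: approximate `V` in `L³` by a continuous compactly
  supported `g` (`MemLp.exists_hasCompactSupport_eLpNorm_sub_le`); the error pairs critically
  (`|∫⟪λ h(x₀ + λ·), φ⟫| ≤ ‖h‖₃ ‖φ‖_{3/2}`), and `|∫⟪λ g(x₀ + λ·), φ⟫| ≤ λ⁻² ‖g‖₁ sup|φ| → 0`.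

## References

* D. Albritton, T. Barker, J. Math. Fluid Mech. 21 (2019), Paper No. 43 = arXiv:1811.00502:
  Prop. 2.3 and its proof (arXiv p. 5); §4, Thm. 4.1 and its proof (arXiv p. 9).
  [`AlbrittonBarker2019`]
* P. G. Lemarié-Rieusset, *The Navier–Stokes Problem in the 21st Century* (CRC 2016),
  doi:10.1201/b19556: Thm. 14.4 (PDF p. 505); proof of Thm. 15.5, pp. 571–573. [`LemarieRieusset2016`]
* W. Rusin, V. Šverák, J. Funct. Anal. 260 (2011) = arXiv:0911.0500, Lemma 2.1. [`RusinSverak2011`]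
-/

noncomputable section

open MeasureTheory TopologicalSpace Set Function Filter Metric Module
open _root_.Topology
open scoped ENNReal NNReal RealInnerProductSpace

namespace Literature.Analysis.FluidPDE

/-! ## Zoomed-out copies of a fixed `L³` field vanish in the sense of distributions -/

/-- **Zoomed-out copies of a fixed `L³` field tend to `0` in the sense of distributions**
(Albritton–Barker 2019, §4, arXiv:1811.00502 p. 9: `L³`-functions belong to the class `𝔹` of
`f ∈ Ḃ^{-1}_{∞,∞}` with "`f(λ·) → 0` in the sense of distributions as `λ → ∞`", whence
"`U^{(k)} → 0` in the sense of distributions" for the final slices of the zoomed-out solutions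
`v^{(k)}(x,t) = √|t_k| v(√|t_k| x, |t_k| t)`). For `V ∈ L³(ℝ³)`, a test field `φ`, a point `x₀` and
scales `λ_n → +∞`, `∫ ⟪λ_n V(x₀ + λ_n x), φ(x)⟫ dx → 0`: write `V = g + h` with `g` continuous and
compactly supported and `‖h‖₃` small; the pairing of `λ_n h(x₀ + λ_n ·)` is at most
`‖h‖₃ ‖φ‖_{3/2}` (Hölder, both factors scale critically), and that of `λ_n g(x₀ + λ_n ·)` equals
`λ_n⁻² ∫⟪g, φ(λ_n⁻¹(· − x₀))⟫`, at most `λ_n⁻² ‖g‖₁ sup|φ|`. [cite: AlbrittonBarker2019, §4 (arXiv:1811.00502 p. 9), definition of 𝔹 and "U^{(k)} → 0"] -/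
theorem tendsto_integral_inner_zoomOut_of_memLp_three
    {V : EuclideanSpace ℝ (Fin 3) → EuclideanSpace ℝ (Fin 3)} (hV : MemLp V 3 volume)
    {φ : EuclideanSpace ℝ (Fin 3) → EuclideanSpace ℝ (Fin 3)}
    (hφ : FunctionSpaces.IsTestFunctionOn (⊤ : Opens (EuclideanSpace ℝ (Fin 3))) φ)
    (x₀ : EuclideanSpace ℝ (Fin 3)) {c : ℕ → ℝ} (hc : ∀ n, 0 < c n)
    (hc' : Tendsto c atTop atTop) :
    Tendsto (fun n => ∫ x, ⟪c n • V (x₀ + c n • x), φ x⟫) atTop (𝓝 0) := by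
  rw [Metric.tendsto_atTop]
  intro ε hε
  -- the test field: sup bound, `L^{3/2}` norm
  have hφc : Continuous φ := hφ.contDiff.continuous
  have hφcs : HasCompactSupport φ := hφ.hasCompactSupport
  obtain ⟨Cφ, hCφ⟩ := hφc.bounded_above_of_compact_support hφcs
  have hCφ0 : 0 ≤ Cφ := (norm_nonneg _).trans (hCφ 0)
  have hφq : MemLp φ (3 / 2 : ℝ≥0∞) volume := hφc.memLp_of_hasCompactSupport hφcs
  set Q : ℝ := (eLpNorm φ (3 / 2 : ℝ≥0∞) volume).toReal with hQdef
  have hQ0 : 0 ≤ Q := ENNReal.toReal_nonneg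
  -- density: `V = g + h`, `g ∈ C_c`, `‖h‖₃ ≤ δ`
  set δ : ℝ := ε / (2 * (Q + 1)) with hδdef
  have hδ : 0 < δ := by positivity
  obtain ⟨g, hgcs, hVg, hgc, hg3⟩ := hV.exists_hasCompactSupport_eLpNorm_sub_le (by norm_num)
    (ε := ENNReal.ofReal δ) (by simpa using hδ)
  set h : EuclideanSpace ℝ (Fin 3) → EuclideanSpace ℝ (Fin 3) := V - g with hhdef
  have hh3 : MemLp h 3 volume := hV.sub hg3
  have hhδ : (eLpNorm h 3 volume).toReal ≤ δ := by
    have := ENNReal.toReal_mono ENNReal.ofReal_ne_top hVg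
    rwa [ENNReal.toReal_ofReal hδ.le] at this
  have hgi : Integrable g := hgc.integrable_of_hasCompactSupport hgcs
  set G : ℝ := ∫ y, ‖g y‖ with hGdef
  have hG0 : 0 ≤ G := integral_nonneg fun _ => norm_nonneg _
  -- large `n`: `c n ≥ L = 2 Cφ G / ε + 1`
  set L : ℝ := 2 * (Cφ * G) / ε + 1 with hLdef
  have hL1 : 1 ≤ L := by
    have h0 : 0 ≤ 2 * (Cφ * G) / ε := by positivity
    rw [hLdef]
    linarith
  obtain ⟨N, hN⟩ := (hc'.eventually_ge_atTop L).exists_forall_of_atTop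
  refine ⟨N, fun n hn => ?_⟩
  have hcn := hc n
  have hcL : L ≤ c n := hN n hn
  have hc1 : 1 ≤ c n := hL1.trans hcL
  rw [Real.dist_eq, sub_zero]
  -- split the pairing
  have hVgh : ∀ y, V y = g y + h y := fun y => by simp [hhdef]
  have hig : Integrable (fun x => ⟪c n • g (x₀ + c n • x), φ x⟫) volume := by
    refine integrable_inner_of_locallyIntegrable_of_hasCompactSupport ?_ hφc hφcs
    have hcont : Continuous fun x => c n • g (x₀ + c n • x) := by fun_prop
    exact hcont.locallyIntegrable
  have hih : Integrable (fun x => ⟪c n • h (x₀ + c n • x), φ x⟫) volume :=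
    integrable_inner_of_locallyIntegrable_of_hasCompactSupport
      ((memLp_three_blowupData hh3 hcn x₀).locallyIntegrable (by norm_num)) hφc hφcs
  have hsplit : ∫ x, ⟪c n • V (x₀ + c n • x), φ x⟫ =
      (∫ x, ⟪c n • g (x₀ + c n • x), φ x⟫) + ∫ x, ⟪c n • h (x₀ + c n • x), φ x⟫ := by
    rw [← integral_add hig hih]
    refine integral_congr_ae (Eventually.of_forall fun x => ?_)
    simp only [hVgh, smul_add, inner_add_left]
  rw [hsplit]
  -- the `g` piece: `|…| ≤ c⁻² Cφ G < ε/2`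
  have hgpiece : |∫ x, ⟪c n • g (x₀ + c n • x), φ x⟫| < ε / 2 := by
    rw [integral_inner_blowup_eq finrank_euclideanSpace_fin g φ hcn x₀, abs_mul,
      abs_of_pos (by positivity : 0 < c n * (c n ^ 3)⁻¹)]
    have hinner : |∫ y, ⟪g y, φ ((c n)⁻¹ • (y - x₀))⟫| ≤ Cφ * G := by
      have h1 : ‖∫ y, ⟪g y, φ ((c n)⁻¹ • (y - x₀))⟫‖ ≤ ∫ y, ‖g y‖ * Cφ :=
        norm_integral_le_of_norm_le (hgi.norm.mul_const Cφ) (Eventually.of_forall fun y => by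
          calc ‖⟪g y, φ ((c n)⁻¹ • (y - x₀))⟫‖ ≤ ‖g y‖ * ‖φ ((c n)⁻¹ • (y - x₀))‖ :=
                norm_inner_le_norm _ _
            _ ≤ ‖g y‖ * Cφ := mul_le_mul_of_nonneg_left (hCφ _) (norm_nonneg _))
      rw [Real.norm_eq_abs, integral_mul_const] at h1
      calc |∫ y, ⟪g y, φ ((c n)⁻¹ • (y - x₀))⟫| ≤ (∫ y, ‖g y‖) * Cφ := h1
        _ = Cφ * G := by rw [hGdef, mul_comm]
    have hfac : c n * (c n ^ 3)⁻¹ ≤ L⁻¹ := by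
      have e : c n * (c n ^ 3)⁻¹ = (c n ^ 2)⁻¹ := by field_simp
      rw [e]
      exact inv_anti₀ (by positivity) (hcL.trans (by nlinarith))
    have hLG : L⁻¹ * (Cφ * G) < ε / 2 := by
      rw [inv_mul_lt_iff₀ (by positivity), hLdef]
      have e : (2 * (Cφ * G) / ε + 1) * (ε / 2) = Cφ * G + ε / 2 := by
        field_simp
      rw [e]
      linarith
    calc c n * (c n ^ 3)⁻¹ * |∫ y, ⟪g y, φ ((c n)⁻¹ • (y - x₀))⟫|
        ≤ L⁻¹ * (Cφ * G) := mul_le_mul hfac hinner (abs_nonneg _) (by positivity)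
      _ < ε / 2 := hLG
  -- the `h` piece: `|…| ≤ ‖h‖₃ ‖φ‖_{3/2} ≤ δ Q < ε/2`
  have hhpiece : |∫ x, ⟪c n • h (x₀ + c n • x), φ x⟫| < ε / 2 := by
    have h1 := abs_integral_inner_le_eLpNorm_three_mul (memLp_three_blowupData hh3 hcn x₀) hφq
    rw [eLpNorm_three_blowupData _ hcn] at h1
    have h2 : (eLpNorm h 3 volume).toReal * Q ≤ δ * Q := mul_le_mul_of_nonneg_right hhδ hQ0
    have h3 : δ * Q < ε / 2 := by
      rw [hδdef, div_mul_eq_mul_div, div_lt_div_iff₀ (by positivity) (by positivity)]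
      nlinarith
    exact (h1.trans h2).trans_lt h3
  calc |(∫ x, ⟪c n • g (x₀ + c n • x), φ x⟫) + ∫ x, ⟪c n • h (x₀ + c n • x), φ x⟫|
      ≤ |∫ x, ⟪c n • g (x₀ + c n • x), φ x⟫| + |∫ x, ⟪c n • h (x₀ + c n • x), φ x⟫| :=
        abs_add_le _ _
    _ < ε / 2 + ε / 2 := add_lt_add hgpiece hhpiece
    _ = ε := by ring

/-! ## Persistence of singularities, quantitative form (Albritton–Barker 2019, Prop. 2.3) -/

/-- **Thm. 14.4 at the final time of a slab, with its bound** (Lemarié-Rieusset 2016, Thm. 14.4,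
PDF p. 505, "`sup_{Q₁} |u| ≤ C₀ λ / r₀`", applied as on p. 573 with `Ω = Q_s(T, x₀)` itself; the
quantitative form is the one Albritton–Barker 2019 use in the proof of Prop. 2.3, arXiv p. 5:
"`limsup_k sup_{Q(r/2)} |v^{(k)}| ≤ C_CKN / r`"). From the proved
`lemarieRieusset_epsilon_regularity_holds` there are `ε₀, C₀ > 0` such that: if `(u, p)` is a
suitable weak solution of the unforced unit-viscosity equations on the open slab `(0, T) × ℝ³` with
`∫_{B₁(x₁)} |u(t)|² ≤ C` for a.e. `t ∈ (0,T)` and all `x₁`, some weak spatial gradient `G` of `u`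
on the slab with `∫₀ᵀ∫_{B₁(x₀)} |G|² < ∞`, and `∫₀ᵀ∫_{B₁(x₀)} |p|^{3/2} < ∞`, then for
`0 < s ≤ 1`, `s² ≤ T`, `C(s; (T,x₀)) + D(s; (T,x₀)) ≤ ε₀³` implies `|u| ≤ C₀ ε₀ / s` a.e. on
`Q_{s/2}(T, x₀)`. The proof is that of the tree's `exists_oneScale_top_of_LR`
(`NSSereginMildStabilityOneScale.lean`), keeping the bound of Thm. 14.4 in the last line.
[cite: LemarieRieusset2016, Thm. 14.4 (PDF p. 505) as applied on p. 573] [cite: AlbrittonBarker2019, Prop. 2.3 (proof, arXiv:1811.00502 p. 5)] -/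
theorem exists_oneScale_top_bound_of_LR' :
    ∃ ε₀ C₀ : ℝ, 0 < ε₀ ∧ 0 < C₀ ∧ ∀ (T : ℝ) (x₀ : EuclideanSpace ℝ (Fin 3)) (s : ℝ)
      (u : ℝ → EuclideanSpace ℝ (Fin 3) → EuclideanSpace ℝ (Fin 3))
      (p : ℝ → EuclideanSpace ℝ (Fin 3) → ℝ) (C : ℝ≥0),
      0 < s → s ≤ 1 → s ^ 2 ≤ T →
      IsSuitableWeakSolutionOn (slab (EuclideanSpace ℝ (Fin 3)) (Ioo 0 T) isOpen_Ioo) 1 0 u p →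
      (∀ᵐ t ∂(volume.restrict (Ioo 0 T)), ∀ x₁ : EuclideanSpace ℝ (Fin 3),
        ∫⁻ x in ball x₁ 1, ‖u t x‖ₑ ^ 2 ≤ C) →
      (∃ G : ℝ → EuclideanSpace ℝ (Fin 3) →
          EuclideanSpace ℝ (Fin 3) →L[ℝ] EuclideanSpace ℝ (Fin 3),
        HasWeakSpatialGradientOn (slab (EuclideanSpace ℝ (Fin 3)) (Ioo 0 T) isOpen_Ioo) u G ∧
          ∫⁻ z in Ioo 0 T ×ˢ ball x₀ 1, ENNReal.ofReal (frobeniusNormSq (G z.1 z.2)) < ∞) →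
      ∫⁻ z in Ioo 0 T ×ˢ ball x₀ 1, ‖p z.1 z.2‖ₑ ^ (3 / 2 : ℝ) < ∞ →
      cknC s ((T : ℝ), x₀) u + cknD s ((T : ℝ), x₀) p ≤ ENNReal.ofReal (ε₀ ^ 3) →
      ∀ᵐ w ∂(volume.restrict (parabolicCylinder (s / 2) ((T : ℝ), x₀))),
        ‖u w.1 w.2‖ ≤ C₀ * ε₀ / s := by
  obtain ⟨ε₀, C₀, hε₀, hC₀, H⟩ :=
    (lemarieRieusset_epsilon_regularity_iff.1 lemarieRieusset_epsilon_regularity_holds) 1 3 one_pos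
      (by norm_num)
  refine ⟨ε₀, C₀, hε₀, hC₀, fun T x₀ s u p C hs hs1 hsT hsws hCu hGu hp hsmall => ?_⟩
  set z : ℝ × EuclideanSpace ℝ (Fin 3) := ((T : ℝ), x₀) with hz
  set Ω : Opens (ℝ × EuclideanSpace ℝ (Fin 3)) := parabolicCylinderOpens s z with hΩ
  have hΩcoe : (Ω : Set (ℝ × EuclideanSpace ℝ (Fin 3))) = parabolicCylinder s z :=
    coe_parabolicCylinderOpens s z
  have hΩbox : (Ω : Set (ℝ × EuclideanSpace ℝ (Fin 3))) ⊆ Ioo (0 : ℝ) T ×ˢ ball x₀ 1 := by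
    rw [hΩcoe]; exact parabolicCylinder_top_subset_box hs1 hsT x₀
  have hΩle : Ω ≤ slab (EuclideanSpace ℝ (Fin 3)) (Ioo 0 T) isOpen_Ioo := by
    intro w hw
    have hw' : w ∈ (Ω : Set (ℝ × EuclideanSpace ℝ (Fin 3))) := hw
    rw [hΩcoe] at hw'
    exact parabolicCylinder_top_subset_slab hsT x₀ hw'
  -- the gradient of the local energy inequality and the bounded gradient agree a.e.
  obtain ⟨G₀, hG₀, -, hloc⟩ := hsws.localEnergy
  obtain ⟨G, hG, hGfin⟩ := hGu
  have hae := hG₀.ae_eq hG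
  have hslabcoe : ((slab (EuclideanSpace ℝ (Fin 3)) (Ioo 0 T) isOpen_Ioo :
      Opens (ℝ × EuclideanSpace ℝ (Fin 3))) : Set (ℝ × EuclideanSpace ℝ (Fin 3))) =
      Ioo (0 : ℝ) T ×ˢ univ := coe_slab _ _
  have hΩslab : (Ω : Set (ℝ × EuclideanSpace ℝ (Fin 3))) ⊆ Ioo (0 : ℝ) T ×ˢ univ :=
    hΩbox.trans (prod_mono Subset.rfl (subset_univ _))
  -- the standing hypotheses of Thm. 14.4 on `Ω`
  have hLR : IsLRSuitableWeakSolutionOn Ω 1 3 0 u p G₀ :=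
    { isConnected := by
        rw [hΩcoe, parabolicCylinder]
        exact (isConnected_Ioo (by nlinarith : z.1 - s ^ 2 < z.1)).prod (isConnected_ball hs)
      energyClass := by
        refine ⟨C, ?_⟩
        have hCu' := (ae_restrict_iff' (measurableSet_Ioo : MeasurableSet (Ioo (0 : ℝ) T))).1 hCu
        filter_upwards [hCu'] with t ht
        rw [hΩcoe, parabolicCylinder,
          lintegral_indicator_prod_slice measurableSet_ball (fun w => ‖u w.1 w.2‖ₑ ^ 2) t]
        have hz1 : z.1 = T := rfl
        have hz2 : z.2 = x₀ := rfl
        rw [hz1, hz2]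
        by_cases htI : t ∈ Ioo (T - s ^ 2) T
        · rw [indicator_of_mem htI]
          have ht0 : t ∈ Ioo (0 : ℝ) T := ⟨by linarith [htI.1], htI.2⟩
          exact (lintegral_mono_set (ball_subset_ball hs1)).trans (ht ht0 x₀)
        · rw [indicator_of_notMem htI]
          exact zero_le
      weakGradient := hG₀.mono hΩle
      gradient_lt_top := by
        have hae' : ∀ᵐ w ∂(volume.restrict (Ω : Set (ℝ × EuclideanSpace ℝ (Fin 3)))),
            ENNReal.ofReal (frobeniusNormSq (G₀ w.1 w.2)) =
              ENNReal.ofReal (frobeniusNormSq (G w.1 w.2)) := by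
          rw [hslabcoe] at hae
          filter_upwards [ae_restrict_of_ae_restrict_of_subset hΩslab hae] with w hw
          have hw' : G₀ w.1 w.2 = G w.1 w.2 := hw
          rw [hw']
        rw [lintegral_congr_ae hae']
        exact (lintegral_mono_set hΩbox).trans_lt hGfin
      pressure_lt_top := (lintegral_mono_set hΩbox).trans_lt hp
      force_memLp := by
        rw [uncurry_zero]
        exact MemLp.zero
      distributional := (hsws.of_le hΩle).distributional
      localEnergy := fun φ hφ hφ0 => hloc φ (hφ.mono hΩle) hφ0 }
  -- (14.17) with `λ = ε₀`
  have hmeas : AEMeasurable (fun w : ℝ × EuclideanSpace ℝ (Fin 3) => ‖u w.1 w.2‖ₑ ^ (3 : ℕ))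
      (volume.restrict (parabolicCylinder s z)) := by
    have h1 : AEStronglyMeasurable (uncurry u)
        (volume.restrict (parabolicCylinder s z)) := by
      have h0 := hsws.distributional.1.aestronglyMeasurable
      rw [hslabcoe] at h0
      exact h0.mono_measure (Measure.restrict_mono (hΩcoe ▸ hΩslab) le_rfl)
    exact (h1.aemeasurable.enorm.pow_const 3)
  have hint : ∫⁻ w in parabolicCylinder s z,
      (‖u w.1 w.2‖ₑ ^ (3 : ℕ) + ‖p w.1 w.2‖ₑ ^ (3 / 2 : ℝ)) ≤ ENNReal.ofReal (ε₀ ^ 3 * s ^ 2) := by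
    rw [lintegral_add_left' hmeas]
    have hs0 : ENNReal.ofReal s ^ 2 ≠ 0 := pow_ne_zero 2 (ENNReal.ofReal_pos.2 hs).ne'
    have hst : ENNReal.ofReal s ^ 2 ≠ ∞ := ENNReal.pow_ne_top ENNReal.ofReal_ne_top
    have h1 : (ENNReal.ofReal s ^ 2)⁻¹ * ((∫⁻ w in parabolicCylinder s z, ‖u w.1 w.2‖ₑ ^ (3 : ℕ)) +
        ∫⁻ w in parabolicCylinder s z, ‖p w.1 w.2‖ₑ ^ (3 / 2 : ℝ)) ≤ ENNReal.ofReal (ε₀ ^ 3) := by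
      rw [mul_add]; exact hsmall
    rw [ENNReal.inv_mul_le_iff hs0 hst] at h1
    refine h1.trans (le_of_eq ?_)
    rw [← ENNReal.ofReal_pow hs.le, ← ENNReal.ofReal_mul (by positivity), mul_comm]
  have hforce : ∫⁻ w in parabolicCylinder s z,
      ‖(0 : ℝ → EuclideanSpace ℝ (Fin 3) → EuclideanSpace ℝ (Fin 3)) w.1 w.2‖ₑ ^ (3 : ℝ) ≤
        ENNReal.ofReal (ε₀ ^ (2 * (3 : ℝ)) * s ^ (5 - 3 * (3 : ℝ))) := by
    simp [ENNReal.zero_rpow_of_pos (by norm_num : (0 : ℝ) < 3)]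
  have hb := H Ω 0 u p G₀ hLR z s ε₀ hs (by rw [hΩcoe]) hε₀.le le_rfl hint hforce
  exact hb.mono fun w hw => hw

/-- **Persistence of singularities, quantitative form at the top of a slab, unit viscosity**
(Albritton–Barker 2019, **Prop. 2.3**, arXiv:1811.00502 p. 5, proof of the contrapositive:
"Suppose that `u ∈ L^∞(Q(R))` for some `0 < R < 1` … `(1/r²)∫_{Q(r)} |u|³ ≤ ε` … because
`u ∈ L^∞(Q(R))` is a subcritical assumption … this ensures
`limsup_{k→∞} sup_{Q(r/2)} |v^{(k)}| ≤ C_CKN / r`"; Lemarié-Rieusset 2016, proof of Thm. 15.5,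
PDF pp. 571–573, (15.5)–(15.6) with Thm. 14.4; Rusin–Šverák 2011, Lemma 2.1). Setting and
hypotheses are those of the tree's `singular_point_stability_unit`
(`NSSereginMildStabilityCore.lean`): slab local Leray solutions `(v_n, π_n)`, `(v_∞, π_∞)` on
`ℝ³ × (0, T)` at unit viscosity with uniform uniformly-local energy bounds and `v_n → v_∞` in
`L²((0,T) × B(0,R))` for every `R`, and `v_∞` essentially bounded on a backward cylinder
`Q_{r₀}(T, x₀)`. Conclusion, **uniform in `n`**: there are `r₁ > 0` and `B` such that
`|v_n| ≤ B` a.e. on `Q_{r₁}(T, x₀)` for all large `n` (`r₁ = s/2`, `B = C₀ ε₀ / s` at the final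
scale `s` of the proof, which is fixed before `n`). The proof is the tree's, verbatim — gauges by
the local pressure bound (`kangMiuraTsai_local_pressure_bound_holds`), cubic terms by the strong
`L³` convergence on the cylinder, the pressure by the iterated decay estimate
(`seregin_sverak_pressure_decay_holds`) — closed by the quantitative Thm. 14.4
(`exists_oneScale_top_bound_of_LR'`) instead of its qualitative corollary.
[cite: AlbrittonBarker2019, Prop. 2.3 (arXiv:1811.00502 p. 5)] [cite: LemarieRieusset2016, proof of Thm. 15.5, PDF pp. 571–573 (15.5)–(15.6) with Thm. 14.4] -/
theorem singular_point_stability_unit_bound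
    {T : ℝ} (hT : 0 < T) (C : ℝ≥0)
    (a : ℕ → EuclideanSpace ℝ (Fin 3) → EuclideanSpace ℝ (Fin 3))
    (v : ℕ → ℝ → EuclideanSpace ℝ (Fin 3) → EuclideanSpace ℝ (Fin 3))
    (π : ℕ → ℝ → EuclideanSpace ℝ (Fin 3) → ℝ)
    (aL : EuclideanSpace ℝ (Fin 3) → EuclideanSpace ℝ (Fin 3))
    (vL : ℝ → EuclideanSpace ℝ (Fin 3) → EuclideanSpace ℝ (Fin 3))
    (πL : ℝ → EuclideanSpace ℝ (Fin 3) → ℝ)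
    (hv : ∀ n, IsLocalLeraySolutionOn T 1 (a n) (v n) (π n))
    (hvL : IsLocalLeraySolutionOn T 1 aL vL πL)
    (hC : ∀ n, ∀ᵐ t ∂(volume.restrict (Ioo 0 T)), ∀ x₀ : EuclideanSpace ℝ (Fin 3),
      ∫⁻ x in ball x₀ 1, ‖v n t x‖ₑ ^ 2 ≤ C)
    (hG : ∀ n, ∃ G : ℝ → EuclideanSpace ℝ (Fin 3) →
        EuclideanSpace ℝ (Fin 3) →L[ℝ] EuclideanSpace ℝ (Fin 3),
      HasWeakSpatialGradientOn (slab (EuclideanSpace ℝ (Fin 3)) (Ioo 0 T) isOpen_Ioo) (v n) G ∧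
        ∀ x₀ : EuclideanSpace ℝ (Fin 3), ∫⁻ z in Ioo 0 T ×ˢ ball x₀ 1,
          ENNReal.ofReal (frobeniusNormSq (G z.1 z.2)) ≤ C)
    (hconv : ∀ R : ℝ, 0 < R →
      Tendsto (fun n => ∫⁻ z in Ioo 0 T ×ˢ ball (0 : EuclideanSpace ℝ (Fin 3)) R,
        ‖v n z.1 z.2 - vL z.1 z.2‖ₑ ^ 2) atTop (𝓝 0))
    (x₀ : EuclideanSpace ℝ (Fin 3))
    (hreg : ∃ r₀ : ℝ, 0 < r₀ ∧ r₀ ^ 2 < T ∧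
      eLpNorm (uncurry vL) ∞ (volume.restrict (parabolicCylinder r₀ ((T : ℝ), x₀))) < ∞) :
    ∃ r₁ : ℝ, 0 < r₁ ∧ ∃ B : ℝ, ∀ᶠ n in atTop,
      ∀ᵐ w ∂(volume.restrict (parabolicCylinder r₁ ((T : ℝ), x₀))), ‖v n w.1 w.2‖ ≤ B := by
  obtain ⟨r₀, hr₀, hr₀T, hbdd⟩ := hreg
  set z : ℝ × EuclideanSpace ℝ (Fin 3) := ((T : ℝ), x₀) with hz
  -- constants of the three facts
  obtain ⟨ε₀, C₀, hε₀, -, hOS⟩ := exists_oneScale_top_bound_of_LR'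
  obtain ⟨c, hPDr⟩ := seregin_sverak_pressure_decay_holds.ratio
  obtain ⟨θ, hθ, hθhalf, hcθ⟩ := exists_ratio_mul_le_half c
  have hθ1 : θ ≤ 1 := hθhalf.trans (by norm_num)
  -- (i) gauges with a uniform pressure bound
  obtain ⟨KP, hKPT⟩ := kangMiuraTsai_local_pressure_bound_holds T 1 (2 * C) hT one_pos
  have hC2 : (C : ℝ≥0∞) ≤ ((2 * C : ℝ≥0) : ℝ≥0∞) := by
    push_cast
    exact le_mul_of_one_le_left bot_le one_le_two
  have hgauge : ∀ n, ∃ cg : ℝ → ℝ, MemLp cg (3 / 2 : ℝ≥0∞) (volume.restrict (Ioo 0 T)) ∧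
      ∫⁻ w in Ioo 0 T ×ˢ ball x₀ 1, ‖π n w.1 w.2 - cg w.1‖ₑ ^ (3 / 2 : ℝ) ≤ KP := by
    intro n
    refine hKPT (a n) (v n) (π n) (hv n) (fun x₁ => ?_) ((hv n).isWeaklyDivFree_datum hT) ?_ ?_ x₀
    · have h1 := (hv n).lintegral_ball_datum_le hT (hC n) x₁
      refine h1.trans (le_of_eq ?_)
      push_cast
      ring
    · filter_upwards [hC n] with t ht x₁
      exact (ht x₁).trans hC2
    · obtain ⟨G, hGn, hGb⟩ := hG n
      exact ⟨G, hGn, fun x₁ => (hGb x₁).trans hC2⟩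
  choose cg hcg hcgb using hgauge
  set p : ℕ → ℝ → EuclideanSpace ℝ (Fin 3) → ℝ := fun n t x => π n t x - cg n t with hp
  have hgs : ∀ n, IsSuitableWeakSolutionOn (slab (EuclideanSpace ℝ (Fin 3)) (Ioo 0 T) isOpen_Ioo)
      1 0 (v n) (p n) := fun n => (hv n).suitable.sub_timeGauge_slab (hcg n)
  -- the essential bound of the limit on `Q_{r₀}(z)`
  set M : ℝ≥0∞ := eLpNorm (uncurry vL) ∞ (volume.restrict (parabolicCylinder r₀ z)) with hMdef
  have hM : ∀ᵐ w ∂(volume.restrict (parabolicCylinder r₀ z)), ‖vL w.1 w.2‖ₑ ≤ M :=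
    ae_enorm_le_eLpNorm_top vL _
  have hMtop : M ≠ ∞ := hbdd.ne
  -- (ii) the radius `ρ` and the `L³` convergence on `Q_ρ(z)`
  set ρ : ℝ := min r₀ 1 with hρdef
  have hρ : 0 < ρ := lt_min hr₀ one_pos
  have hρ1 : ρ ≤ 1 := min_le_right _ _
  have hρr₀ : ρ ≤ r₀ := min_le_left _ _
  have hρT : ρ ^ 2 ≤ T := (pow_le_pow_left₀ hρ.le hρr₀ 2).trans hr₀T.le
  obtain ⟨CL, hCL⟩ := hvL.uniformLocalEnergy 1 one_pos
  obtain ⟨GLim, hGLim, hGLimb⟩ := hvL.uniformLocalGradient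
  obtain ⟨CL', hCL'⟩ := hGLimb 1 one_pos
  set C' : ℝ≥0∞ := (C : ℝ≥0∞) + CL + CL' with hC'
  have hC'top : C' ≠ ∞ := by simp [hC']
  have hCC' : (C : ℝ≥0∞) ≤ C' := by rw [hC', add_assoc]; exact le_self_add
  have hCLC' : (CL : ℝ≥0∞) ≤ C' := by
    rw [hC']; exact le_add_self.trans le_self_add
  have hCL'C' : (CL' : ℝ≥0∞) ≤ C' := by rw [hC']; exact le_add_self
  have hconv1 : Tendsto (fun n => ∫⁻ w in Ioo 0 T ×ˢ ball x₀ 1,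
      ‖v n w.1 w.2 - vL w.1 w.2‖ₑ ^ 2) atTop (𝓝 0) := by
    have hsub : Ioo (0 : ℝ) T ×ˢ ball x₀ 1 ⊆
        Ioo (0 : ℝ) T ×ˢ ball (0 : EuclideanSpace ℝ (Fin 3)) (‖x₀‖ + 1) := by
      refine prod_mono Subset.rfl fun y hy => ?_
      rw [mem_ball, dist_zero_right]
      rw [mem_ball, dist_eq_norm] at hy
      linarith [norm_sub_norm_le y x₀]
    exact tendsto_of_tendsto_of_tendsto_of_le_of_le tendsto_const_nhds
      (hconv (‖x₀‖ + 1) (by positivity)) (fun _ => bot_le) fun n => lintegral_mono_set hsub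
  have hδ : Tendsto (fun n => ∫⁻ w in parabolicCylinder ρ z,
      ‖v n w.1 w.2 - vL w.1 w.2‖ₑ ^ (3 : ℕ)) atTop (𝓝 0) := by
    refine tendsto_lintegral_cube_parabolicCylinder hρ hρ1 hρT hC'top
      (fun n => (hv n).aestronglyMeasurable) hvL.aestronglyMeasurable (fun n => ?_) (fun n => ?_)
      ?_ ?_ hconv1
    · filter_upwards [hC n] with t ht x₁
      exact (ht x₁).trans hCC'
    · obtain ⟨G, hGn, hGb⟩ := hG n
      exact ⟨G, hGn, (hGb x₀).trans hCC'⟩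
    · filter_upwards [hCL] with t ht x₁
      exact (ht x₁).trans hCLC'
    · exact ⟨GLim, hGLim, (hCL' x₀).trans hCL'C'⟩
  -- constants
  set V₁ : ℝ≥0∞ := volume (ball (0 : EuclideanSpace ℝ (Fin 3)) 1) with hV₁
  have hV₁top : V₁ ≠ ∞ := measure_ball_lt_top.ne
  set Θ : ℝ≥0∞ := ENNReal.ofReal ((θ⁻¹) ^ 2) with hΘ
  set L : ℝ≥0∞ := 1 + 2 * ((c : ℝ≥0∞) * Θ) with hL
  have hLtop : L ≠ ∞ := ENNReal.add_ne_top.2 ⟨ENNReal.one_ne_top, ENNReal.mul_ne_top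
    ENNReal.ofNat_ne_top (ENNReal.mul_ne_top ENNReal.coe_ne_top ENNReal.ofReal_ne_top)⟩
  set ε : ℝ≥0∞ := ENNReal.ofReal (ε₀ ^ 3) with hεdef
  have hε4 : 0 < ε / 4 :=
    ENNReal.div_pos (ENNReal.ofReal_pos.2 (by positivity)).ne' ENNReal.ofNat_ne_top
  -- (A) the starting radius `rB ≤ ρ`: `L · 4 |B₁| M³ rB³ ≤ ε/4`
  obtain ⟨rA, hrA, hA⟩ := exists_forall_ofReal_pow_three_mul_le (N := L * (4 * (V₁ * M ^ 3)))
    (ENNReal.mul_ne_top hLtop (ENNReal.mul_ne_top ENNReal.ofNat_ne_top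
      (ENNReal.mul_ne_top hV₁top (ENNReal.pow_ne_top hMtop)))) hε4
  set rB : ℝ := min ρ rA with hrBdef
  have hrB : 0 < rB := lt_min hρ hrA
  have hrBρ : rB ≤ ρ := min_le_left _ _
  have hrB1 : rB ≤ 1 := hrBρ.trans hρ1
  have hrBr₀ : rB ≤ r₀ := hrBρ.trans hρr₀
  have hrBT : rB ^ 2 ≤ T := (pow_le_pow_left₀ hrB.le hrBρ 2).trans hρT
  have hArB : ENNReal.ofReal (rB ^ 3) * (L * (4 * (V₁ * M ^ 3))) ≤ ε / 4 :=
    hA rB hrB (min_le_right _ _)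
  -- (B) the number of steps `J`
  set P : ℝ≥0∞ := (ENNReal.ofReal rB ^ 2)⁻¹ * KP with hPdef
  have hPtop : P ≠ ∞ :=
    ENNReal.mul_ne_top (ENNReal.inv_ne_top.2 (pow_ne_zero 2 (ENNReal.ofReal_pos.2 hrB).ne'))
      ENNReal.coe_ne_top
  obtain ⟨J, hJ⟩ := exists_inv_two_pow_mul_le hPtop hε4
  -- the final scale `s = θᴶ rB`
  set s : ℝ := θ ^ J * rB with hsdef
  have hs : 0 < s := by positivity
  have hsrB : s ≤ rB := mul_le_of_le_one_left hrB.le (pow_le_one₀ hθ.le hθ1)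
  have hs1 : s ≤ 1 := hsrB.trans hrB1
  have hsT : s ^ 2 ≤ T := (pow_le_pow_left₀ hs.le hsrB 2).trans hrBT
  have hscale0 : ∀ j : ℕ, 0 < θ ^ j * rB := fun j => by positivity
  have hscale1 : ∀ j : ℕ, θ ^ j * rB ≤ rB := fun j =>
    mul_le_of_le_one_left hrB.le (pow_le_one₀ hθ.le hθ1)
  have hscale2 : ∀ j ≤ J, s ≤ θ ^ j * rB := fun j hj =>
    mul_le_mul_of_nonneg_right (pow_le_pow_of_le_one hθ.le hθ1 hj) hrB.le
  -- (C) large `n`: the `L³` error is small at the scale `s`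
  have hevT : ∀ᶠ n : ℕ in atTop, L * (4 * ((ENNReal.ofReal s ^ 2)⁻¹ *
      ∫⁻ w in parabolicCylinder ρ z, ‖v n w.1 w.2 - vL w.1 w.2‖ₑ ^ (3 : ℕ))) ≤ ε / 4 := by
    have hfin : L * (4 * (ENNReal.ofReal s ^ 2)⁻¹) ≠ ∞ :=
      ENNReal.mul_ne_top hLtop (ENNReal.mul_ne_top ENNReal.ofNat_ne_top
        (ENNReal.inv_ne_top.2 (pow_ne_zero 2 (ENNReal.ofReal_pos.2 hs).ne')))
    have h1 := ENNReal.Tendsto.const_mul hδ (Or.inr hfin)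
    rw [mul_zero] at h1
    have h2 : Tendsto (fun n : ℕ => L * (4 * ((ENNReal.ofReal s ^ 2)⁻¹ *
        ∫⁻ w in parabolicCylinder ρ z, ‖v n w.1 w.2 - vL w.1 w.2‖ₑ ^ (3 : ℕ)))) atTop (𝓝 0) := by
      refine h1.congr fun n => ?_
      simp only [mul_assoc]
    exact h2.eventually (ge_mem_nhds hε4)
  refine ⟨s / 2, by positivity, C₀ * ε₀ / s, ?_⟩
  filter_upwards [hevT] with n hnT
  -- the cubic inputs of the approximant `v n`
  set Tn : ℝ≥0∞ := ∫⁻ w in parabolicCylinder ρ z, ‖v n w.1 w.2 - vL w.1 w.2‖ₑ ^ (3 : ℕ) with hTn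
  set e : ℝ≥0∞ := 4 * (V₁ * M ^ 3 * ENNReal.ofReal (rB ^ 3)) + 4 * ((ENNReal.ofReal s ^ 2)⁻¹ * Tn)
    with hedef
  have hCe : ∀ j ≤ J, cknC (θ ^ j * rB) z (v n) ≤ e := by
    intro j hj
    have hQS : parabolicCylinder (θ ^ j * rB) z ⊆ parabolicCylinder r₀ z :=
      parabolicCylinder_mono (hscale0 j).le ((hscale1 j).trans hrBr₀) z
    have hQK : parabolicCylinder (θ ^ j * rB) z ⊆ parabolicCylinder ρ z :=
      parabolicCylinder_mono (hscale0 j).le ((hscale1 j).trans hrBρ) z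
    refine (cknC_le_of_ae_bound_of_lintegral_sub (hscale0 j) hQS hQK hM le_rfl).trans ?_
    have h1 : ENNReal.ofReal ((θ ^ j * rB) ^ 3) ≤ ENNReal.ofReal (rB ^ 3) :=
      ENNReal.ofReal_le_ofReal (pow_le_pow_left₀ (hscale0 j).le (hscale1 j) 3)
    have h2 : (ENNReal.ofReal (θ ^ j * rB) ^ 2)⁻¹ ≤ (ENNReal.ofReal s ^ 2)⁻¹ :=
      ENNReal.inv_le_inv.2 (pow_le_pow_left' (ENNReal.ofReal_le_ofReal (hscale2 j hj)) 2)
    rw [hedef]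
    gcongr
  -- (iii) the pressure of the approximant at the last scale
  have hsubQ : parabolicCylinder rB z ⊆
      ((slab (EuclideanSpace ℝ (Fin 3)) (Ioo 0 T) isOpen_Ioo : Opens (ℝ × EuclideanSpace ℝ (Fin 3)))
        : Set (ℝ × EuclideanSpace ℝ (Fin 3))) := parabolicCylinder_top_subset_slab hrBT x₀
  have hD : cknD s z (p n) ≤
      (2⁻¹ : ℝ≥0∞) ^ J * cknD rB z (p n) + 2 * ((c : ℝ≥0∞) * Θ * e) :=
    cknD_iterate_le_of_pressure_decay hPDr hθ hθ1 hcθ (hgs n).distributional hrB hsubQ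
      (fun j hj => hCe j hj.le)
  have hD0 : cknD rB z (p n) ≤ P :=
    (cknD_le_of_subset (p n) (parabolicCylinder_top_subset_box hrB1 hrBT x₀)).trans
      (mul_le_mul' le_rfl (hcgb n))
  -- smallness `C + D ≤ ε` at the scale `s`
  have hsmall : cknC s z (v n) + cknD s z (p n) ≤ ε := by
    have h1 : cknC s z (v n) ≤ e := hCe J le_rfl
    have h2 : L * e ≤ ε / 4 + ε / 4 := by
      rw [hedef, mul_add]
      refine add_le_add ?_ hnT
      calc L * (4 * (V₁ * M ^ 3 * ENNReal.ofReal (rB ^ 3)))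
          = ENNReal.ofReal (rB ^ 3) * (L * (4 * (V₁ * M ^ 3))) := by ring
        _ ≤ ε / 4 := hArB
    have h3 : (2⁻¹ : ℝ≥0∞) ^ J * cknD rB z (p n) ≤ ε / 4 := le_trans (by gcongr) hJ
    calc cknC s z (v n) + cknD s z (p n)
        ≤ e + ((2⁻¹ : ℝ≥0∞) ^ J * cknD rB z (p n) + 2 * ((c : ℝ≥0∞) * Θ * e)) :=
          add_le_add h1 hD
      _ = L * e + (2⁻¹ : ℝ≥0∞) ^ J * cknD rB z (p n) := by rw [hL]; ring
      _ ≤ (ε / 4 + ε / 4) + ε / 4 := add_le_add h2 h3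
      _ ≤ ε := ENNReal.add_quarters_le ε
  -- Thm. 14.4 on `Ω = Q_s(T, x₀)`
  obtain ⟨G, hGn, hGb⟩ := hG n
  exact hOS T x₀ s (v n) (p n) C hs hs1 hsT (hgs n) (hC n)
    ⟨G, hGn, (hGb x₀).trans_lt ENNReal.coe_lt_top⟩ ((hcgb n).trans_lt ENNReal.coe_lt_top) hsmall

end Literature.Analysis.FluidPDE

end
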